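import Summits.QuantumFields.BalabanUV.Beta.EriceFlowEnclosureB12AsPrintedHistoryContagionShiftFlowPicardLimit

/-!
# Beta / EriceFlowEnclosureB12AsPrintedHistoryContagionShiftFlowPicardOpen — ASYMPTOTIC FREEDOM IS CONTAGIOUS, part 19: ASYMPTOTIC FREEDOM IS AN OPEN CONDITION.
# Parts 12–13 ran node U2's lattice-free Picard scheme (`T4BetaFlowWellPosed.picard ∕ iterate ∕ solution`) floor-free from ONE asymptotically free reference solution of
# the SAME functional.  The reference enters only through the BASE PROPERTY `1∕(4e²) + (β*∕4)m ≤ 1∕e² + drive B u m` for box histories u ≤ 2e (part 12's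
# `base_lower_of_envelope`); §21 re-runs the scheme from that property ALONE (`exists_memFlow_of_base`), and §22 observes that the property passes from B to EVERY
# functional B′ that is η-close to B on the box, at the rate β* − 4η (`base_of_close`: `drive B′ ≥ drive B − η·m`).  HENCE (§23) **every functional with a memory profile
# lying within η < β*∕4 of one admitting an asymptotically free box solution has, from every small pin, a box solution of its own flow with memory, asymptotically free at
# rate (β* − 4η)∕4 — which then serves as ITS OWN reference**, so parts 10 ∕ 13 ∕ 14 ∕ 16 (uniqueness, well-posedness, two-pin and functional laws) apply to B′ near zero
# pin: the class of functionals whose limit RG equation is well posed near zero renormalized coupling is OPEN in the sup norm on the box.  Part 20 reads it on the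
# as-printed carrier: Theorem 2 AS TYPED for ONE Setting makes the flow of EVERY nearby limit functional well posed — Theorem 2 is not asked of the perturbation.
# Abstract in B, B′ (β-flow team, prover 1, unit `b2b-balaban-beta-bflow-p1`, gen 37; ROW AP-I·Uc × NODE U2)

HONEST FRAMING (page 1 of everything the β sub-cell writes): discharging `BetaPertH` makes Bałaban's UV stability UNCONDITIONAL — a
real constructive-QFT result; it is NOT the continuum limit and NOT the Clay problem.  HONEST DEPENDENCY (cell reorg 2026-08-19,
verbatim): «continuum YM on T⁴ ⇐ BetaPertH ∧ nine spine estimates (0/9 proved); BetaPertH ⇐ (D1) ∧ (D4) ∧ CAP+tail; G-an2-4 gates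
asym, D1 and NE2/3/4.»  THIS MODULE DISCHARGES NOTHING: [folklore] real analysis (parts 12–13's iteration re-run from an abstract base property; one triangle inequality
for the perturbation) over node U2's HYPOTHESIS SHAPES `T4BetaStationary.{SeqBox, MemoryProfile}`, `T4BetaFlowWellPosed.{MemFlow, drive, picard, iterate, solution, bbar}` on
ABSTRACT functionals `B, B′ : (ℕ → ℝ) → ℝ` — node U2's hypothesis shapes, which node U2 derives for Bałaban's limit functional from NE4 ∕ moduli LETTERS (NOT PRINTED for
[I] = T. Bałaban, Commun. Math. Phys. **109** (1987) [Balaban1987RG1]: GAPS G-t4-U2-1 ∕ -2; the quarter profile is the shape of (0.31)'s lower half, Theorem 2 p. 259,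
STATED WITHOUT PROOF).  The η-closeness of a second functional is a HYPOTHESIS about an abstract B′; nothing of Bałaban's β is asserted; nothing of node U2's modules is
restated or modified (`picard`, `drive`, `bbar`, `drive_le_mul_bbar`, `abs_drive_sub_drive_le`, `memFlow_of_invSq_eq`, `one_div_sqrt_le` USED BY NAME).

WHAT THIS FILE PROVES (0 sorry, 0 def): §21 `picard_mem_of_base`, `picardIter_mem_of_base`, `picardIter_profile_of_base`, `invSq_picardIter_succ_of_base`,
`abs_invSq_picardIter_succ_sub_le_of_base`, `dist_picardIter_succ_le_of_base`, **`exists_memFlow_of_base`**; §22 `base_of_reference`, **`base_of_close`**; §23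
**`exists_memFlow_of_close`** (B with an AF reference, B′ with a memory profile and `|B − B′| ≤ η`, `4η < β*` ⟹ from every small pin B′'s flow has a box solution,
AF at rate (β* − 4η)∕4, the scale-wise limit of `(picard B′ e)^[n] u`), **`existsUnique_memFlow_of_close`** (… which is B′'s own reference: `∃!` for B′ below its
threshold).  NOT CLAIMED: anything about Bałaban's β; the carrier reading (part 20); `BetaPertH`; the continuum limit of the measures; Clay.
-/

namespace Summit.QuantumFields.BalabanUV.Beta.EriceFlowEnclosureB12AsPrintedHistoryContagionShiftFlowPicardOpen

open Finset Filter Topology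
open Literature.MathematicalPhysics.QuantumFieldTheory.Balaban1983to89
open Literature.MathematicalPhysics.QuantumFieldTheory.Balaban1983to89.T4CouplingMatching (prof sprof sprof_pos sprof_sq prof_pos abs_sub_le_of_inv_sq)
open Literature.MathematicalPhysics.QuantumFieldTheory.Balaban1983to89.T4BetaStationary (SeqBox MemoryProfile summable_profile abs_sub_le_of_seqBox
  tsum_profile_le)
open Literature.MathematicalPhysics.QuantumFieldTheory.Balaban1983to89.T4BetaFlowWellPosed (MemFlow drive drive_succ drive_zero picard iterate solution
  seqBox_shift invSq_eq_of_memFlow memFlow_of_invSq_eq abs_drive_sub_drive_le bbar drive_le_mul_bbar)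
open Summit.QuantumFields.BalabanUV.Beta.EriceFlowEnclosureB12AsPrintedHistoryContagionProfile (le_two_mul_of_profile)
open Summit.QuantumFields.BalabanUV.Beta.EriceFlowEnclosureB12AsPrintedHistoryContagionShiftFlow (le_invSprof_of_prof_le memFlow_unique_of_reference)
open Summit.QuantumFields.BalabanUV.Beta.EriceFlowEnclosureB12AsPrintedHistoryContagionShiftFlowPicard (base_lower_of_envelope invSq_picard picard_pos_of_base_pos
  abs_drive_sub_drive_le_weighted mul_le_inv_pow kappa_le_half)
open Summit.QuantumFields.BalabanUV.Beta.EriceFlowEnclosureB12AsPrintedHistoryContagionShiftFlowPicardLimit (tendsto_drive_of_tendsto prof_le_invSq_of_le_invSprof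
  existsUnique_memFlow_of_reference)

noncomputable section

/-! ## §21 The Picard scheme from the base property alone -/

/-- THE SOLUTION MAP UNDER THE BASE PROPERTY: if `1∕(4e²) + (β*∕4)m ≤ 1∕e² + drive B u m` for every box history u ≤ 2e (β* ≥ 0, 0 < e, 2e ≤ γ), then `picard B e` maps the class
«box, ≤ 2e» into itself WITH the quarter profile. [folklore] -/
theorem picard_mem_of_base {B : (ℕ → ℝ) → ℝ} {γ bs e : ℝ} {u : ℕ → ℝ} (hbs : 0 ≤ bs) (he : 0 < e) (h2e : 2 * e ≤ γ)
    (hbase : ∀ v : ℕ → ℝ, SeqBox γ v → (∀ q, v q ≤ 2 * e) → ∀ m : ℕ, 1 / (4 * e ^ 2) + bs / 4 * (m : ℝ) ≤ 1 / e ^ 2 + drive B v m)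
    (hus : SeqBox γ u) (henv : ∀ q, u q ≤ 2 * e) :
    SeqBox γ (picard B e u) ∧ (∀ m : ℕ, 1 / (4 * e ^ 2) + bs / 4 * (m : ℝ) ≤ 1 / (picard B e u m) ^ 2) ∧ ∀ q, picard B e u q ≤ 2 * e := by
  have hb := hbase u hus henv
  have hS : ∀ m : ℕ, 0 < 1 / e ^ 2 + drive B u m := fun m =>
    (by positivity : (0 : ℝ) < 1 / (4 * e ^ 2) + bs / 4 * (m : ℝ)).trans_le (hb m)
  have hprof' : ∀ m : ℕ, 1 / (4 * e ^ 2) + bs / 4 * (m : ℝ) ≤ 1 / (picard B e u m) ^ 2 := fun m => by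
    rw [invSq_picard (hS m)]; exact hb m
  have hpos : ∀ m, 0 < picard B e u m := fun m => picard_pos_of_base_pos (hS m)
  have hle : ∀ q, picard B e u q ≤ 2 * e := fun q => le_two_mul_of_profile hbs he (hpos q) (Nat.cast_nonneg q) (hprof' q)
  exact ⟨fun q => ⟨hpos q, (hle q).trans h2e⟩, hprof', hle⟩

/-- Every iterate from an enveloped start is box-valued and ≤ 2e (base property). [folklore] -/
theorem picardIter_mem_of_base {B : (ℕ → ℝ) → ℝ} {γ bs e : ℝ} {u : ℕ → ℝ} (hbs : 0 ≤ bs) (he : 0 < e) (h2e : 2 * e ≤ γ)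
    (hbase : ∀ v : ℕ → ℝ, SeqBox γ v → (∀ q, v q ≤ 2 * e) → ∀ m : ℕ, 1 / (4 * e ^ 2) + bs / 4 * (m : ℝ) ≤ 1 / e ^ 2 + drive B v m)
    (hus : SeqBox γ u) (henv : ∀ q, u q ≤ 2 * e) :
    ∀ n : ℕ, SeqBox γ ((picard B e)^[n] u) ∧ ∀ q, (picard B e)^[n] u q ≤ 2 * e := by
  intro n
  induction n with
  | zero => exact ⟨hus, henv⟩
  | succ n ih =>
    rw [Function.iterate_succ_apply']
    have h := picard_mem_of_base hbs he h2e hbase ih.1 ih.2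
    exact ⟨h.1, h.2.2⟩

/-- From the first step on the iterates carry the quarter profile (base property). [folklore] -/
theorem picardIter_profile_of_base {B : (ℕ → ℝ) → ℝ} {γ bs e : ℝ} {u : ℕ → ℝ} (hbs : 0 ≤ bs) (he : 0 < e) (h2e : 2 * e ≤ γ)
    (hbase : ∀ v : ℕ → ℝ, SeqBox γ v → (∀ q, v q ≤ 2 * e) → ∀ m : ℕ, 1 / (4 * e ^ 2) + bs / 4 * (m : ℝ) ≤ 1 / e ^ 2 + drive B v m)
    (hus : SeqBox γ u) (henv : ∀ q, u q ≤ 2 * e) (n m : ℕ) :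
    1 / (4 * e ^ 2) + bs / 4 * (m : ℝ) ≤ 1 / ((picard B e)^[n + 1] u m) ^ 2 := by
  rw [Function.iterate_succ_apply']
  have ih := picardIter_mem_of_base hbs he h2e hbase hus henv n
  exact (picard_mem_of_base hbs he h2e hbase ih.1 ih.2).2.1 m

/-- The chart identity along the iteration (base property). [folklore] -/
theorem invSq_picardIter_succ_of_base {B : (ℕ → ℝ) → ℝ} {γ bs e : ℝ} {u : ℕ → ℝ} (hbs : 0 ≤ bs) (he : 0 < e) (h2e : 2 * e ≤ γ)
    (hbase : ∀ v : ℕ → ℝ, SeqBox γ v → (∀ q, v q ≤ 2 * e) → ∀ m : ℕ, 1 / (4 * e ^ 2) + bs / 4 * (m : ℝ) ≤ 1 / e ^ 2 + drive B v m)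
    (hus : SeqBox γ u) (henv : ∀ q, u q ≤ 2 * e) (n m : ℕ) :
    1 / ((picard B e)^[n + 1] u m) ^ 2 = 1 / e ^ 2 + drive B ((picard B e)^[n] u) m := by
  rw [Function.iterate_succ_apply']
  have ih := picardIter_mem_of_base hbs he h2e hbase hus henv n
  exact invSq_picard ((by positivity : (0 : ℝ) < 1 / (4 * e ^ 2) + bs / 4 * (m : ℝ)).trans_le (hbase _ ih.1 ih.2 m))

/-- Consecutive iterates contract in the θ₁-weighted chart (base property + memory profile). [folklore] -/
theorem abs_invSq_picardIter_succ_sub_le_of_base {B : (ℕ → ℝ) → ℝ} {Cm θ θ₁ γ bs e : ℝ} {u : ℕ → ℝ}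
    (hB : MemoryProfile Cm θ γ B) (hCm : 0 ≤ Cm) (hθ0 : 0 ≤ θ) (hθ1 : θ < 1) (hbs : 0 ≤ bs) (he : 0 < e) (h2e : 2 * e ≤ γ)
    (hbase : ∀ v : ℕ → ℝ, SeqBox γ v → (∀ q, v q ≤ 2 * e) → ∀ m : ℕ, 1 / (4 * e ^ 2) + bs / 4 * (m : ℝ) ≤ 1 / e ^ 2 + drive B v m)
    (hus : SeqBox γ u) (henv : ∀ q, u q ≤ 2 * e) (hθθ₁ : θ < θ₁) (hθ₁1 : θ₁ < 1) :
    ∀ n q : ℕ, |1 / ((picard B e)^[n + 2] u q) ^ 2 - 1 / ((picard B e)^[n + 1] u q) ^ 2|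
      ≤ (8 * Cm * e ^ 3 / ((1 - θ / θ₁) * (1 - θ₁))) ^ n * (Cm * (γ / (1 - θ)) / (1 - θ₁)) / θ₁ ^ q := by
  have hmem := picardIter_mem_of_base hbs he h2e hbase hus henv
  have hinv := invSq_picardIter_succ_of_base hbs he h2e hbase hus henv
  have hθ₁0 : 0 < θ₁ := lt_of_le_of_lt hθ0 hθθ₁
  have h1θ₁ : 0 < 1 - θ₁ := by linarith
  have h1θ : 0 < 1 - θ := by linarith
  have hγ : 0 ≤ γ := (hus 0).1.le.trans (hus 0).2
  have hA₀0 : 0 ≤ Cm * (γ / (1 - θ)) / (1 - θ₁) := by positivity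
  intro n
  induction n with
  | zero =>
    intro q
    rw [hinv 1 q, hinv 0 q, add_sub_add_left_eq_sub, pow_zero, one_mul]
    have h := abs_drive_sub_drive_le (B' := B) (η := 0) hB hCm hθ0 hθ1 (fun v _ => by simp) (hmem 1).1 (hmem 0).1
      (D := γ) (fun i => abs_sub_le_of_seqBox (hmem 1).1 (hmem 0).1 i) q
    rw [add_zero] at h
    calc |drive B ((picard B e)^[1] u) q - drive B ((picard B e)^[0] u) q| ≤ (q : ℝ) * (Cm * (γ / (1 - θ))) := h
      _ = ((q : ℝ) * (1 - θ₁)) * (Cm * (γ / (1 - θ)) / (1 - θ₁)) := by field_simp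
      _ ≤ (1 / θ₁ ^ q) * (Cm * (γ / (1 - θ)) / (1 - θ₁)) := mul_le_mul_of_nonneg_right (mul_le_inv_pow hθ₁0 hθ₁1 q) hA₀0
      _ = Cm * (γ / (1 - θ)) / (1 - θ₁) / θ₁ ^ q := by ring
  | succ n ih =>
    intro q
    rw [show n + 1 + 2 = n + 2 + 1 from rfl, hinv (n + 2) q, hinv (n + 1) q, add_sub_add_left_eq_sub]
    have hp := abs_drive_sub_drive_le_weighted hB hCm hθ0 hθθ₁ hθ₁1 he.le (hmem (n + 2)).1 (hmem (n + 1)).1 (hmem (n + 2)).2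
      (hmem (n + 1)).2 ih q
    calc |drive B ((picard B e)^[n + 2] u) q - drive B ((picard B e)^[n + 1] u) q|
        ≤ 8 * Cm * e ^ 3 / ((1 - θ / θ₁) * (1 - θ₁)) * ((8 * Cm * e ^ 3 / ((1 - θ / θ₁) * (1 - θ₁))) ^ n
            * (Cm * (γ / (1 - θ)) / (1 - θ₁))) / θ₁ ^ q := hp
      _ = (8 * Cm * e ^ 3 / ((1 - θ / θ₁) * (1 - θ₁))) ^ (n + 1) * (Cm * (γ / (1 - θ)) / (1 - θ₁)) / θ₁ ^ q := by
          rw [pow_succ]; ring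

/-- In the coupling chart consecutive iterates are `(8e³A₀∕θ₁^q)·κ^n`-close (base property + memory profile). [folklore] -/
theorem dist_picardIter_succ_le_of_base {B : (ℕ → ℝ) → ℝ} {Cm θ θ₁ γ bs e : ℝ} {u : ℕ → ℝ}
    (hB : MemoryProfile Cm θ γ B) (hCm : 0 ≤ Cm) (hθ0 : 0 ≤ θ) (hθ1 : θ < 1) (hbs : 0 ≤ bs) (he : 0 < e) (h2e : 2 * e ≤ γ)
    (hbase : ∀ v : ℕ → ℝ, SeqBox γ v → (∀ q, v q ≤ 2 * e) → ∀ m : ℕ, 1 / (4 * e ^ 2) + bs / 4 * (m : ℝ) ≤ 1 / e ^ 2 + drive B v m)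
    (hus : SeqBox γ u) (henv : ∀ q, u q ≤ 2 * e) (hθθ₁ : θ < θ₁) (hθ₁1 : θ₁ < 1) (q n : ℕ) :
    dist ((picard B e)^[n + 1] u q) ((picard B e)^[n + 1 + 1] u q)
      ≤ (8 * e ^ 3 * (Cm * (γ / (1 - θ)) / (1 - θ₁)) / θ₁ ^ q) * (8 * Cm * e ^ 3 / ((1 - θ / θ₁) * (1 - θ₁))) ^ n := by
  have hmem := picardIter_mem_of_base hbs he h2e hbase hus henv
  have hdiff := abs_invSq_picardIter_succ_sub_le_of_base hB hCm hθ0 hθ1 hbs he h2e hbase hus henv hθθ₁ hθ₁1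
  have hθ₁0 : 0 < θ₁ := lt_of_le_of_lt hθ0 hθθ₁
  have hr1 : θ / θ₁ < 1 := (div_lt_one hθ₁0).mpr hθθ₁
  have h1r : 0 < 1 - θ / θ₁ := by linarith
  have h1θ₁ : 0 < 1 - θ₁ := by linarith
  have h1θ : 0 < 1 - θ := by linarith
  have hγ : 0 ≤ γ := (hus 0).1.le.trans (hus 0).2
  rw [Real.dist_eq]
  have ha := ((hmem (n + 1)).1 q).1
  have hb := ((hmem (n + 1 + 1)).1 q).1
  have hw : ((picard B e)^[n + 1] u q) ^ 2 * (picard B e)^[n + 1 + 1] u q ≤ 8 * e ^ 3 := by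
    have h1 : ((picard B e)^[n + 1] u q) ^ 2 ≤ (2 * e) ^ 2 := pow_le_pow_left₀ ha.le ((hmem (n + 1)).2 q) 2
    calc ((picard B e)^[n + 1] u q) ^ 2 * (picard B e)^[n + 1 + 1] u q ≤ (2 * e) ^ 2 * (2 * e) :=
          mul_le_mul h1 ((hmem (n + 1 + 1)).2 q) hb.le (by positivity)
      _ = 8 * e ^ 3 := by ring
  have hd : |1 / ((picard B e)^[n + 1] u q) ^ 2 - 1 / ((picard B e)^[n + 1 + 1] u q) ^ 2|
      ≤ (8 * Cm * e ^ 3 / ((1 - θ / θ₁) * (1 - θ₁))) ^ n * (Cm * (γ / (1 - θ)) / (1 - θ₁)) / θ₁ ^ q := by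
    rw [abs_sub_comm]; exact hdiff n q
  calc |(picard B e)^[n + 1] u q - (picard B e)^[n + 1 + 1] u q|
      ≤ ((picard B e)^[n + 1] u q) ^ 2 * (picard B e)^[n + 1 + 1] u q
          * |1 / ((picard B e)^[n + 1] u q) ^ 2 - 1 / ((picard B e)^[n + 1 + 1] u q) ^ 2| := abs_sub_le_of_inv_sq ha hb
    _ ≤ 8 * e ^ 3 * ((8 * Cm * e ^ 3 / ((1 - θ / θ₁) * (1 - θ₁))) ^ n * (Cm * (γ / (1 - θ)) / (1 - θ₁)) / θ₁ ^ q) :=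
        mul_le_mul hw hd (abs_nonneg _) (by positivity)
    _ = (8 * e ^ 3 * (Cm * (γ / (1 - θ)) / (1 - θ₁)) / θ₁ ^ q) * (8 * Cm * e ^ 3 / ((1 - θ / θ₁) * (1 - θ₁))) ^ n := by ring

/-- **EXISTENCE FROM THE BASE PROPERTY ALONE.**  `B` with memory profile `(C_m, θ)` on ]0, γ]^ℕ; a pin `0 < e`, `2e ≤ γ`, `64C_m e³ ≤ (1 − θ)²`; the base property of
(B, e, β*) (β* ≥ 0); ANY box start u ≤ 2e.  THEN the iterates `(picard B e)^[n] u` converge scale by scale to a box solution h of `MemFlow B e h` with the quarter profile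
(parts 12–13 verbatim, the reference replaced by the base property). [folklore] -/
theorem exists_memFlow_of_base {B : (ℕ → ℝ) → ℝ} {Cm θ γ bs e : ℝ} {u : ℕ → ℝ}
    (hB : MemoryProfile Cm θ γ B) (hCm : 0 ≤ Cm) (hθ0 : 0 ≤ θ) (hθ1 : θ < 1) (hbs : 0 ≤ bs) (he : 0 < e) (h2e : 2 * e ≤ γ)
    (hbase : ∀ v : ℕ → ℝ, SeqBox γ v → (∀ q, v q ≤ 2 * e) → ∀ m : ℕ, 1 / (4 * e ^ 2) + bs / 4 * (m : ℝ) ≤ 1 / e ^ 2 + drive B v m)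
    (hus : SeqBox γ u) (henv : ∀ q, u q ≤ 2 * e) (hs4 : 64 * Cm * e ^ 3 ≤ (1 - θ) ^ 2) :
    ∃ h : ℕ → ℝ, SeqBox γ h ∧ MemFlow B e h ∧ (∀ m : ℕ, 1 / (4 * e ^ 2) + bs / 4 * (m : ℝ) ≤ 1 / (h m) ^ 2) ∧
      ∀ q, Tendsto (fun n => (picard B e)^[n] u q) atTop (𝓝 (h q)) := by
  obtain ⟨hθθ₁, hθ₁1, hκ0, hκ1⟩ := kappa_le_half hCm hθ0 hθ1 he.le hs4
  set θ₁ : ℝ := (1 + θ) / 2 with hθ₁def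
  set κ : ℝ := 8 * Cm * e ^ 3 / ((1 - θ / θ₁) * (1 - θ₁)) with hκdef
  set A₀ : ℝ := Cm * (γ / (1 - θ)) / (1 - θ₁) with hA₀def
  have hκ1' : κ < 1 := by linarith
  have hγ0 : 0 < γ := by linarith
  have hmem := picardIter_mem_of_base hbs he h2e hbase hus henv
  have hprofit := picardIter_profile_of_base hbs he h2e hbase hus henv
  have hinv := invSq_picardIter_succ_of_base hbs he h2e hbase hus henv
  have hstep : ∀ q n, dist ((picard B e)^[n + 1] u q) ((picard B e)^[n + 1 + 1] u q) ≤ (8 * e ^ 3 * A₀ / θ₁ ^ q) * κ ^ n :=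
    fun q n => dist_picardIter_succ_le_of_base hB hCm hθ0 hθ1 hbs he h2e hbase hus henv hθθ₁ hθ₁1 q n
  have hcauchy : ∀ q, CauchySeq fun n => (picard B e)^[n + 1] u q := fun q =>
    cauchySeq_of_le_geometric κ (8 * e ^ 3 * A₀ / θ₁ ^ q) hκ1' (hstep q)
  refine ⟨fun q => limUnder atTop fun n => (picard B e)^[n] u q, ?_⟩
  have hlim : ∀ q, Tendsto (fun n => (picard B e)^[n] u q) atTop (𝓝 (limUnder atTop fun n => (picard B e)^[n] u q)) := by
    intro q
    obtain ⟨L, hL⟩ := cauchySeq_tendsto_of_complete (hcauchy q)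
    exact tendsto_nhds_limUnder ⟨L, (tendsto_add_atTop_iff_nat 1).mp hL⟩
  set h : ℕ → ℝ := fun q => limUnder atTop fun n => (picard B e)^[n] u q with hhdef
  have hlim1 : ∀ q, Tendsto (fun n => (picard B e)^[n + 1] u q) atTop (𝓝 (h q)) := fun q =>
    (tendsto_add_atTop_iff_nat 1).mpr (hlim q)
  have hlow : ∀ (q n : ℕ), 1 / Real.sqrt (1 / e ^ 2 + (q : ℝ) * bbar B Cm θ γ) ≤ (picard B e)^[n + 1] u q := by
    intro q n
    have hM : 1 / ((picard B e)^[n + 1] u q) ^ 2 ≤ 1 / e ^ 2 + (q : ℝ) * bbar B Cm θ γ := by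
      rw [hinv n q]; linarith [drive_le_mul_bbar hB hCm hθ0 hθ1 hγ0 (hmem n).1 q]
    exact T4BetaFlowWellPosed.one_div_sqrt_le ((hmem (n + 1)).1 q).1 hM
  have hposh : ∀ q, 0 < h q := by
    intro q
    have hM0 : 0 < 1 / e ^ 2 + (q : ℝ) * bbar B Cm θ γ := by
      have hp1 := ((hmem (0 + 1)).1 q).1
      have hM : 1 / ((picard B e)^[0 + 1] u q) ^ 2 ≤ 1 / e ^ 2 + (q : ℝ) * bbar B Cm θ γ := by
        rw [hinv 0 q]; linarith [drive_le_mul_bbar hB hCm hθ0 hθ1 hγ0 (hmem 0).1 q]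
      exact (one_div_pos.mpr (pow_pos hp1 2)).trans_le hM
    exact (one_div_pos.mpr (Real.sqrt_pos.mpr hM0)).trans_le (ge_of_tendsto' (hlim1 q) fun n => hlow q n)
  have hhs : SeqBox γ h := fun q => ⟨hposh q, le_of_tendsto' (hlim q) fun n => ((hmem n).1 q).2⟩
  have h2e0 : 0 < 2 * e := by positivity
  have hb4 : 0 ≤ bs / 4 := by positivity
  have e4 : (2 * e) ^ 2 = 4 * e ^ 2 := by ring
  have hprofh : ∀ m : ℕ, 1 / (4 * e ^ 2) + bs / 4 * (m : ℝ) ≤ 1 / (h m) ^ 2 := by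
    intro m
    have hle : ∀ n, (picard B e)^[n + 1] u m ≤ 1 / sprof (2 * e) (bs / 4) m := fun n =>
      le_invSprof_of_prof_le h2e0 hb4 ((hmem (n + 1)).1 m).1 (by rw [e4]; exact hprofit n m)
    have := prof_le_invSq_of_le_invSprof h2e0 hb4 (hposh m) (le_of_tendsto' (hlim1 m) hle)
    rwa [e4] at this
  have hflow : ∀ m, 1 / (h m) ^ 2 = 1 / e ^ 2 + drive B h m := by
    intro m
    have h1 : Tendsto (fun n => 1 / ((picard B e)^[n + 1] u m) ^ 2) atTop (𝓝 (1 / e ^ 2 + drive B h m)) :=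
      ((tendsto_drive_of_tendsto hB hθ0 hθ1 (fun n => (hmem n).1) hhs hlim m).const_add (1 / e ^ 2)).congr'
        (Eventually.of_forall fun n => (hinv n m).symm)
    have h2 : Tendsto (fun n => 1 / ((picard B e)^[n + 1] u m) ^ 2) atTop (𝓝 (1 / (h m) ^ 2)) :=
      tendsto_const_nhds.div ((hlim1 m).pow 2) (pow_ne_zero 2 (hposh m).ne')
    exact tendsto_nhds_unique h2 h1
  exact ⟨hhs, memFlow_of_invSq_eq he hposh hflow, hprofh, hlim⟩

/-! ## §22 Sources of the base property: the reference (part 12), and η-closeness to a functional that has it -/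

/-- THE REFERENCE GIVES THE BASE PROPERTY (part 12's `base_lower_of_envelope`, repackaged). [cite: Balaban1987RG1, Thm 2 (0.31) p.259 with (0.20) p.256] -/
theorem base_of_reference {B : (ℕ → ℝ) → ℝ} {Cm θ γ bs ta gs e : ℝ} {t : ℕ → ℝ}
    (hB : MemoryProfile Cm θ γ B) (hCm : 0 ≤ Cm) (hθ0 : 0 ≤ θ) (hθ1 : θ < 1) (hbs : 0 < bs) (hta : 0 < ta)
    (hts : SeqBox γ t) (htf : MemFlow B gs t) (hprof : ∀ m : ℕ, 1 / ta ^ 2 + bs * (m : ℝ) ≤ 1 / (t m) ^ 2) (he : 0 < e)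
    (hs1 : 4 * Cm * e ≤ bs * (1 - θ))
    (hs2 : e ^ 2 * (1 / gs ^ 2 + Cm * γ / (1 - θ) ^ 2 + (2 * Cm / ((1 - θ) * bs)) ^ 2) ≤ 3 / 4) :
    ∀ v : ℕ → ℝ, SeqBox γ v → (∀ q, v q ≤ 2 * e) → ∀ m : ℕ, 1 / (4 * e ^ 2) + bs / 4 * (m : ℝ) ≤ 1 / e ^ 2 + drive B v m :=
  fun _ hvs hvenv => base_lower_of_envelope hB hCm hθ0 hθ1 hbs hta hts htf hprof he hvs hvenv hs1 hs2

/-- **THE BASE PROPERTY IS OPEN**: if (B, e, β*) has it and `|B u − B′ u| ≤ η` for all box histories u, then (B′, e, β* − 4η) has it — each of the m memory terms moves by at most η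
(node U2's `abs_drive_sub_drive_le` with D = 0). [folklore] -/
theorem base_of_close {B B' : (ℕ → ℝ) → ℝ} {Cm θ γ bs e η : ℝ}
    (hB : MemoryProfile Cm θ γ B) (hCm : 0 ≤ Cm) (hθ0 : 0 ≤ θ) (hθ1 : θ < 1)
    (hbase : ∀ v : ℕ → ℝ, SeqBox γ v → (∀ q, v q ≤ 2 * e) → ∀ m : ℕ, 1 / (4 * e ^ 2) + bs / 4 * (m : ℝ) ≤ 1 / e ^ 2 + drive B v m)
    (hη : ∀ u, SeqBox γ u → |B u - B' u| ≤ η) :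
    ∀ v : ℕ → ℝ, SeqBox γ v → (∀ q, v q ≤ 2 * e) → ∀ m : ℕ, 1 / (4 * e ^ 2) + (bs - 4 * η) / 4 * (m : ℝ) ≤ 1 / e ^ 2 + drive B' v m := by
  intro v hvs hvenv m
  have h1 := hbase v hvs hvenv m
  have h2 := abs_drive_sub_drive_le hB hCm hθ0 hθ1 hη hvs hvs (D := 0) (fun j => by simp) m
  simp only [zero_div, mul_zero, zero_add] at h2
  have h3 := (abs_sub_le_iff.mp h2).1
  have e1 : (bs - 4 * η) / 4 * (m : ℝ) = bs / 4 * (m : ℝ) - (m : ℝ) * η := by ring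
  rw [e1]
  linarith

/-! ## §23 Openness of well-posedness near zero pin -/

/-- **ASYMPTOTIC FREEDOM IS AN OPEN CONDITION.**  `B` with memory profile `(C_m, θ)` on ]0, γ]^ℕ and ONE asymptotically free reference solution (t from g*, rate β*, pin t_a);
`B′` with memory profile `(C_m, θ)` on the same box and `|B u − B′ u| ≤ η` for all box u, `4η < β*`; a pin `0 < e`, `2e ≤ γ` below B's threshold (`4C_m e ≤ β*(1 − θ)`,
`e²·(1∕g*² + C_mγ∕(1 − θ)² + (2C_m∕((1 − θ)β*))²) ≤ 3∕4`, `64C_m e³ ≤ (1 − θ)²`); ANY box start u ≤ 2e.  THEN B′'s OWN flow with memory has a box solution h′ from e,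
`MemFlow B′ e h′`, asymptotically free at the rate β* − 4η (`1∕(4e²) + ((β* − 4η)∕4)m ≤ 1∕h′(m)²`), the scale-wise limit of `(picard B′ e)^[n] u` — NO reference solution and NO
floor is asked of B′. [cite: Balaban1987RG1, Thm 2 (0.31) p.259 with (0.20) p.256 and p.298] -/
theorem exists_memFlow_of_close {B B' : (ℕ → ℝ) → ℝ} {Cm θ γ bs ta gs e η : ℝ} {t u : ℕ → ℝ}
    (hB : MemoryProfile Cm θ γ B) (hB' : MemoryProfile Cm θ γ B') (hCm : 0 ≤ Cm) (hθ0 : 0 ≤ θ) (hθ1 : θ < 1) (hbs : 0 < bs) (hta : 0 < ta)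
    (hts : SeqBox γ t) (htf : MemFlow B gs t) (hprof : ∀ m : ℕ, 1 / ta ^ 2 + bs * (m : ℝ) ≤ 1 / (t m) ^ 2)
    (hη : ∀ u, SeqBox γ u → |B u - B' u| ≤ η) (hη4 : 4 * η < bs)
    (he : 0 < e) (h2e : 2 * e ≤ γ) (hus : SeqBox γ u) (henv : ∀ q, u q ≤ 2 * e)
    (hs1 : 4 * Cm * e ≤ bs * (1 - θ))
    (hs2 : e ^ 2 * (1 / gs ^ 2 + Cm * γ / (1 - θ) ^ 2 + (2 * Cm / ((1 - θ) * bs)) ^ 2) ≤ 3 / 4)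
    (hs4 : 64 * Cm * e ^ 3 ≤ (1 - θ) ^ 2) :
    ∃ h' : ℕ → ℝ, SeqBox γ h' ∧ MemFlow B' e h' ∧ (∀ m : ℕ, 1 / (4 * e ^ 2) + (bs - 4 * η) / 4 * (m : ℝ) ≤ 1 / (h' m) ^ 2) ∧
      ∀ q, Tendsto (fun n => (picard B' e)^[n] u q) atTop (𝓝 (h' q)) :=
  exists_memFlow_of_base hB' hCm hθ0 hθ1 (by linarith) he h2e
    (base_of_close hB hCm hθ0 hθ1 (base_of_reference hB hCm hθ0 hθ1 hbs hta hts htf hprof he hs1 hs2) hη) hus henv hs4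

/-- **… AND THE PERTURBED FUNCTIONAL IS WELL POSED NEAR ZERO WITH ITS OWN REFERENCE.**  Under the hypotheses of `exists_memFlow_of_close`, the solution h′ of B′ from the pin e
is an asymptotically free reference FOR B′ (pin e, t_a′ = 2e, rate β′ = (β* − 4η)∕4); hence (part 13's `existsUnique_memFlow_of_reference` for B′) for every pin e″ with
`0 < e″`, `2e″ ≤ γ`, `4C_m e″ ≤ β′(1 − θ)`, `e″²·(1∕e² + C_mγ∕(1 − θ)² + (2C_m∕((1 − θ)β′))²) ≤ 3∕4`, `64C_m e″³ ≤ (1 − θ)²`: **`∃! h, SeqBox γ h ∧ MemFlow B′ e″ h`**.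
[cite: Balaban1987RG1, Thm 2 (0.31) p.259 with (0.20) p.256 and p.298] -/
theorem existsUnique_memFlow_of_close {B B' : (ℕ → ℝ) → ℝ} {Cm θ γ bs ta gs e η e'' : ℝ} {t : ℕ → ℝ}
    (hB : MemoryProfile Cm θ γ B) (hB' : MemoryProfile Cm θ γ B') (hCm : 0 ≤ Cm) (hθ0 : 0 ≤ θ) (hθ1 : θ < 1) (hbs : 0 < bs) (hta : 0 < ta)
    (hts : SeqBox γ t) (htf : MemFlow B gs t) (hprof : ∀ m : ℕ, 1 / ta ^ 2 + bs * (m : ℝ) ≤ 1 / (t m) ^ 2)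
    (hη : ∀ u, SeqBox γ u → |B u - B' u| ≤ η) (hη4 : 4 * η < bs)
    (he : 0 < e) (h2e : 2 * e ≤ γ)
    (hs1 : 4 * Cm * e ≤ bs * (1 - θ))
    (hs2 : e ^ 2 * (1 / gs ^ 2 + Cm * γ / (1 - θ) ^ 2 + (2 * Cm / ((1 - θ) * bs)) ^ 2) ≤ 3 / 4)
    (hs4 : 64 * Cm * e ^ 3 ≤ (1 - θ) ^ 2)
    (he'' : 0 < e'') (h2e'' : 2 * e'' ≤ γ)
    (hs1'' : 4 * Cm * e'' ≤ (bs - 4 * η) / 4 * (1 - θ))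
    (hs2'' : e'' ^ 2 * (1 / e ^ 2 + Cm * γ / (1 - θ) ^ 2 + (2 * Cm / ((1 - θ) * ((bs - 4 * η) / 4))) ^ 2) ≤ 3 / 4)
    (hs4'' : 64 * Cm * e'' ^ 3 ≤ (1 - θ) ^ 2) :
    ∃! h : ℕ → ℝ, SeqBox γ h ∧ MemFlow B' e'' h := by
  have hus : SeqBox γ (fun _ : ℕ => e) := fun _ => ⟨he, by linarith⟩
  have henv : ∀ q : ℕ, (fun _ : ℕ => e) q ≤ 2 * e := fun _ => by simp only; linarith
  obtain ⟨h', hhs', hhf', hprof', -⟩ :=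
    exists_memFlow_of_close hB hB' hCm hθ0 hθ1 hbs hta hts htf hprof hη hη4 he h2e hus henv hs1 hs2 hs4
  have h2e0 : 0 < 2 * e := by positivity
  have hb' : 0 < (bs - 4 * η) / 4 := by linarith
  have hprof2 : ∀ m : ℕ, 1 / (2 * e) ^ 2 + (bs - 4 * η) / 4 * (m : ℝ) ≤ 1 / (h' m) ^ 2 := fun m => by
    have e4 : 1 / (2 * e) ^ 2 = 1 / (4 * e ^ 2) := by ring
    rw [e4]; exact hprof' m
  exact existsUnique_memFlow_of_reference hB' hCm hθ0 hθ1 hb' h2e0 hhs' hhf' hprof2 he'' h2e'' hs1'' hs2'' hs4''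

end

end Summit.QuantumFields.BalabanUV.Beta.EriceFlowEnclosureB12AsPrintedHistoryContagionShiftFlowPicardOpen
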